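import Summits.QuantumFields.YangMills.Theorems.ConvexGribovBodyPoincareToGapDuality
import Summits.QuantumFields.YangMills.Theorems.FradkinShenkerFlowSusceptibilityToPoincareTwoBlockFactorization

/-!
# One-slice retention ⇒ the one-slice projection bound
(crux `ConvexGribovBody.PoincareToGap`, line `Sketch`, stub L2)

Torus `(ℤ/(2S+1))⁴`, time = coordinate `0`, Wilson state `μ = wilsonMeasure r.ρ β` (a probability
measure), one time slice `s : ℤ/(2S+1)` with spatial links
`X := {e | (e.1 0 - s).val = 0 ∧ e.2 ≠ 0}`, its complement `O := {e | ¬ (…)}`, and the heat-bath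
projections `P_D := μ[· | cylinderEvents D]`.

`stub_oneSliceProjectionBound_of_retention`: for `0 ≤ θ`, IF every bounded measurable gauge-invariant
`F` reading only `X` retains the fraction `1 − θ` of its variance under `P_O`,
`(1 − θ) Var F ≤ ∫ (F − P_O F)²`, THEN every bounded measurable gauge-invariant `h` reading only `O`
has the projection bound `Var(P_X h) ≤ θ · Var h`.

Proof.  By Pythagoras for the orthogonal projection `P_D` applied to the centred function `f − c`
(`c = ∫ f`; `P_D (f − c) = P_D f − c`), `∫ (f − P_D f)² = Var f − ∫ (P_D f − c)²`, so for a single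
`f ∈ L²` the retention inequality `(1 − θ) Var f ≤ ∫ (f − P_D f)²` is EQUIVALENT to the projection
bound `∫ (P_D f − c)² ≤ θ Var f` (`integral_condExp_sub_sq_le_of_retention`).  Hence the premise says:
every bounded measurable gauge-invariant `F` reading `X` has `Var(P_O F) ≤ θ Var F`; the landed duality
`stub_retention_of_projectionBound` (H1a), applied with its two link sets EXCHANGED (`E := O`, `O := X`),
turns this into retention `(1 − θ) Var h ≤ ∫ (h − P_X h)²` for every bounded measurable gauge-invariant
`h` reading `O`, and Pythagoras once more gives `Var(P_X h) ≤ θ Var h`.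

References: F. Martinelli, LNM 1717 (1999), §3 (block heat-bath projections in `L²`: for closed
subspaces the operator norms `‖P_O|H_X‖` and `‖P_X|H_O‖` coincide).
-/

noncomputable section

open scoped BigOperators Topology
open MeasureTheory ProbabilityTheory Filter
open Literature.MathematicalPhysics.QuantumFieldTheory Literature.MathematicalPhysics.QuantumLattice

namespace Summit.QuantumFields.YangMills.Theorems.PoincareToGap

open Summit.QuantumFields.YangMills.Theorems.SusceptibilityToPoincare

/-! ### Abstract `L²` facts on a finite measure space -/

section L2

variable {Ω : Type*} {m0 : MeasurableSpace Ω} {μ : Measure Ω}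

/-- A measurable real function bounded by `M` is in `L²` of a finite measure. -/
private theorem memLp_two_of_abs_le_const [IsFiniteMeasure μ] {f : Ω → ℝ} (hf : Measurable f)
    {M : ℝ} (hb : ∀ x, |f x| ≤ M) : MemLp f 2 μ :=
  MemLp.of_bound hf.aestronglyMeasurable M (ae_of_all _ fun x => by rw [Real.norm_eq_abs]; exact hb x)

/-- Conditional expectation commutes with subtracting a constant: `P_m (f − c) = P_m f − c` a.e. -/
private theorem condExp_sub_const_ae' [IsFiniteMeasure μ] {m : MeasurableSpace Ω} (hm : m ≤ m0)
    {f : Ω → ℝ} (hf : Integrable f μ) (c : ℝ) :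
    μ[fun ω => f ω - c|m] =ᵐ[μ] fun ω => μ[f|m] ω - c := by
  -- adapted from `ConvexGribovBodyPoincareToGapGlue.lean` (private there)
  have e : (fun ω => f ω - c) = f - fun _ => c := rfl
  rw [e]
  refine (condExp_sub hf (integrable_const c) m).trans ?_
  rw [condExp_const hm c]
  exact Eventually.of_forall fun ω => rfl

/-- Centred Pythagoras for the orthogonal projection `μ[·|m]`: for `f ∈ L²` and any constant `c`,
`∫ (f − μ[f|m])² = ∫ (f − c)² − ∫ (μ[f|m] − c)²`. -/
private theorem integral_sub_condExp_sq_centred [IsFiniteMeasure μ] {m : MeasurableSpace Ω}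
    (hm : m ≤ m0) {f : Ω → ℝ} (hf : MemLp f 2 μ) (c : ℝ) :
    ∫ ω, (f ω - μ[f|m] ω) ^ 2 ∂μ =
      ∫ ω, (f ω - c) ^ 2 ∂μ - ∫ ω, (μ[f|m] ω - c) ^ 2 ∂μ := by
  have hP : μ[fun ω => f ω - c|m] =ᵐ[μ] fun ω => μ[f|m] ω - c :=
    condExp_sub_const_ae' hm (hf.integrable one_le_two) c
  have p : ∫ ω, ((f ω - c) - μ[fun ω => f ω - c|m] ω) ^ 2 ∂μ =
      ∫ ω, (f ω - c) ^ 2 ∂μ - ∫ ω, (μ[fun ω => f ω - c|m] ω) ^ 2 ∂μ :=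
    TwoBlock.integral_sub_condExp_sq hm (hf.sub (memLp_const c))
  have ea : ∫ ω, ((f ω - c) - μ[fun ω => f ω - c|m] ω) ^ 2 ∂μ = ∫ ω, (f ω - μ[f|m] ω) ^ 2 ∂μ := by
    refine integral_congr_ae ?_
    filter_upwards [hP] with ω hω
    rw [hω]
    ring
  have eb : ∫ ω, (μ[fun ω => f ω - c|m] ω) ^ 2 ∂μ = ∫ ω, (μ[f|m] ω - c) ^ 2 ∂μ :=
    integral_sq_congr_ae hP
  rw [ea, eb] at p
  exact p

/-- Retention ⇒ projection bound for ONE function: if `(1 − θ) ∫ (f − c)² ≤ ∫ (f − μ[f|m])²` then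
`∫ (μ[f|m] − c)² ≤ θ ∫ (f − c)²` (centred Pythagoras). -/
private theorem integral_condExp_sub_sq_le_of_retention [IsFiniteMeasure μ] {m : MeasurableSpace Ω}
    (hm : m ≤ m0) {f : Ω → ℝ} (hf : MemLp f 2 μ) (c θ : ℝ)
    (H : (1 - θ) * ∫ ω, (f ω - c) ^ 2 ∂μ ≤ ∫ ω, (f ω - μ[f|m] ω) ^ 2 ∂μ) :
    ∫ ω, (μ[f|m] ω - c) ^ 2 ∂μ ≤ θ * ∫ ω, (f ω - c) ^ 2 ∂μ := by
  rw [integral_sub_condExp_sq_centred hm hf c] at H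
  linarith

end L2

/-! ### The stub -/

/-- `stub_oneSliceProjectionBound_of_retention` — **one-slice retention ⇒ the one-slice projection bound
(L2 of the line `Sketch`)**.  On one torus and one slice `s`, with `X = X_s` (spatial links of slice `s`),
`O = X_sᶜ`, `0 ≤ θ`: if every bounded measurable gauge-invariant `F` reading `X` keeps the fraction `1 − θ`
of its variance under `P_O`, `(1 − θ) Var F ≤ ‖F − P_O F‖²`, then every bounded measurable
gauge-invariant `h` reading `O` has `Var(P_X h) ≤ θ Var h`.  Proof: centred Pythagoras turns the premise
into the projection bound `Var(P_O F) ≤ θ Var F` for `F` reading `X`; the duality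
`stub_retention_of_projectionBound` with `(E, O) := (O, X)` gives retention `(1 − θ) Var h ≤ ‖h − P_X h‖²`
for `h` reading `O`; centred Pythagoras again gives `Var(P_X h) = Var h − ‖h − P_X h‖² ≤ θ Var h`. -/
theorem stub_oneSliceProjectionBound_of_retention :
    ∀ (G : Type) [Group G] [TopologicalSpace G] [IsTopologicalGroup G] [CompactSpace G]
      [MeasurableSpace G] [BorelSpace G] (r : LatticeRep G) (β : ℝ) (S : ℕ)
      (μ : Measure (GaugeConfig 4 (2 * S + 1) G)),
      μ = (wilsonMeasure r.ρ β : Measure (GaugeConfig 4 (2 * S + 1) G)) →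
    ∀ (s : ZMod (2 * S + 1)) (θ : ℝ), 0 ≤ θ →
    (∀ F : GaugeConfig 4 (2 * S + 1) G → ℝ, Measurable F → (∃ M : ℝ, ∀ U, |F U| ≤ M) →
      IsGaugeInvariant F → DependsOn F {e : Edge 4 (2 * S + 1) | (e.1 0 - s).val = 0 ∧ e.2 ≠ 0} →
      (1 - θ) * ∫ U, (F U - ∫ V, F V ∂μ) ^ 2 ∂μ ≤
        ∫ U, (F U - condExp (cylinderEvents
          {e : Edge 4 (2 * S + 1) | ¬ ((e.1 0 - s).val = 0 ∧ e.2 ≠ 0)}) μ F U) ^ 2 ∂μ) →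
    ∀ h : GaugeConfig 4 (2 * S + 1) G → ℝ, Measurable h → (∃ M : ℝ, ∀ U, |h U| ≤ M) →
      IsGaugeInvariant h → DependsOn h {e : Edge 4 (2 * S + 1) | ¬ ((e.1 0 - s).val = 0 ∧ e.2 ≠ 0)} →
    ∫ U, (condExp (cylinderEvents {e : Edge 4 (2 * S + 1) | (e.1 0 - s).val = 0 ∧ e.2 ≠ 0}) μ h U -
        ∫ V, h V ∂μ) ^ 2 ∂μ ≤ θ * ∫ U, (h U - ∫ V, h V ∂μ) ^ 2 ∂μ := by
  intro G _ _ _ _ _ _ r β S μ hμ s θ hθ hRet h hm hb hGI hdep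
  haveI : IsProbabilityMeasure μ := by
    rw [hμ]
    exact isProbabilityMeasure_wilsonMeasure (d := 4) (L := 2 * S + 1) r.ρ r.continuous β
  have hXle : cylinderEvents (X := fun _ : Edge 4 (2 * S + 1) => G)
      {e : Edge 4 (2 * S + 1) | (e.1 0 - s).val = 0 ∧ e.2 ≠ 0} ≤ MeasurableSpace.pi :=
    cylinderEvents_le_pi
  have hOle : cylinderEvents (X := fun _ : Edge 4 (2 * S + 1) => G)
      {e : Edge 4 (2 * S + 1) | ¬ ((e.1 0 - s).val = 0 ∧ e.2 ≠ 0)} ≤ MeasurableSpace.pi :=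
    cylinderEvents_le_pi
  -- (i) the premise, read through centred Pythagoras: the projection bound for `P_O` on `X`-readers
  have hPB : ∀ F : GaugeConfig 4 (2 * S + 1) G → ℝ, Measurable F → (∃ M : ℝ, ∀ U, |F U| ≤ M) →
      IsGaugeInvariant F → DependsOn F {e : Edge 4 (2 * S + 1) | (e.1 0 - s).val = 0 ∧ e.2 ≠ 0} →
      ∫ U, (condExp (cylinderEvents {e : Edge 4 (2 * S + 1) | ¬ ((e.1 0 - s).val = 0 ∧ e.2 ≠ 0)}) μ F U -
          ∫ V, F V ∂μ) ^ 2 ∂μ ≤ θ * ∫ U, (F U - ∫ V, F V ∂μ) ^ 2 ∂μ := by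
    intro F hFm hFb hFGI hFdep
    obtain ⟨M, hFb⟩ := hFb
    exact integral_condExp_sub_sq_le_of_retention hOle (memLp_two_of_abs_le_const hFm hFb) _ θ
      (hRet F hFm ⟨M, hFb⟩ hFGI hFdep)
  -- (ii) duality with the two link sets exchanged: retention under `P_X` for `O`-readers
  have hret := stub_retention_of_projectionBound G r β S μ hμ
    {e : Edge 4 (2 * S + 1) | ¬ ((e.1 0 - s).val = 0 ∧ e.2 ≠ 0)}
    {e : Edge 4 (2 * S + 1) | (e.1 0 - s).val = 0 ∧ e.2 ≠ 0} θ hθ hPB h hm hb hGI hdep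
  -- (iii) centred Pythagoras once more
  obtain ⟨M, hb⟩ := hb
  exact integral_condExp_sub_sq_le_of_retention hXle (memLp_two_of_abs_le_const hm hb) _ θ hret

end Summit.QuantumFields.YangMills.Theorems.PoincareToGap

end
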